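import Summits.AtomisticToContinuum.Crystallization.Theorems.ReggeStarCoercivityDefectFreeCrystallizesPalmDefs
import Summits.AtomisticToContinuum.Crystallization.Theorems.ReggeStarCoercivityDefectFreeCrystallizesGoodLaw
import Summits.AtomisticToContinuum.Crystallization.Theorems.PalmUnimodularRigidityMinimiserShellsThresholdTransfer
import Summits.AtomisticToContinuum.Crystallization.Theorems.PalmUnimodularRigidityMinimiserShellsSlackEventTransfer
import Summits.AtomisticToContinuum.Crystallization.Theorems.MinimiserShells.Negative.LoadBearing

/-!
# P3a `FunnelToShells` of line `palm-good-law` (crux stmt-AtomisticToContinuum-13603): reduction to a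
# deterministic THRESHOLD PRICING on the funnel, via the class-general transfer of crux 9225's line

`FunnelToShells` (`Theorems/ReggeStarCoercivityDefectFreeCrystallizesPalmDefs.lean`): a minimising point-stationary
law on rooted `δ`-hard-core configurations that is almost surely carried by everywhere-`SetGood` configurations
(the `1/20`-funnel) has, almost surely, the `(1/100)`-close-packed ROOT shell of crux 9225 `MinimiserShells`
(`LoadBearing.GoodShell`, verbatim).

This file proves three sorry-free facts about it.

* `funnelToShells_of_minimiserShells` — P3a is implied by crux 9225 outright (the funnel hypothesis dropped).
* `funnelToShells_of_funnelThresholdPricing` — **the deterministic sufficient condition.**  It suffices to prove the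
  THRESHOLD PRICING of deep badly-shelled sites on large cube windows, *restricted to the funnel*: for every hard core
  `δ > 0` and threshold `t > 0` there are `L₀, R₀, κ > 0` such that for every `δ`-separated Sütő `μ`GSC `S` of
  Lennard-Jones at `μ = e*` ALL OF WHOSE POINTS ARE `SetGood` (this is the only difference with the last open stub
  S7″ `stub_thresholdBadPricing` of crux 9225's line `equilibrium-in-law-surgery`), every window `C = S ∩ Q` (`Q` a
  half-open cube of side `L ≥ L₀`) whose `R₀`-deep badly-shelled sites `G` number at least `t·#C` satisfies
  `#C·(e* + κ) ≤ ½ ∑∑_C V_LJ`.  Proof: crux 9225's landed machinery is class-general — S1 `EquilibriumInLaw` (minimising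
  laws are a.s. carried by e*-`μ`GSCs, fed with S2 = item 9229 `EnergyFloor`), the funnel hypothesis and
  `eq_of_count_restrict_eq` put a.e. configuration in the class `K S := IsMuGSC ∧ everywhere-SetGood`; the slack event
  transfer S8a (`SlackEventTransfer.stub_slackEventTransfer`, landed) and the class-general threshold transfer
  (`ThresholdTransfer.ae_goodShell_of_thresholdBadPricing`, landed) conclude.
* `funnelThresholdPricing_of_thresholdBadPricing` — the funnel pricing is a trivial weakening of S7″, so that
  P3a ⇐ S7″ (`funnelToShells_of_thresholdBadPricing`): crux 13603 is closed modulo {S7″ of 9225 (or its funnel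
  restriction), 9227, 9226}.

The funnel restriction is where the crux's own hypothesis (zero defect density, through P1) pays: inside the class
every site is `1/20`-good, so the pricing is the ELASTIC / stacking exactification at the `1 %` scale (no icosahedral,
Frank–Kasper or amorphous competitor is in the class), whereas S7″ is the full frustration crux.
-/

noncomputable section

open MeasureTheory
open scoped ENNReal BigOperators

namespace Summit.AtomisticToContinuum.Crystallization.Theorems.PalmGoodLaw

open Literature.Probability.Process (IsPointStationaryLaw IsRootedHardCore)
open Literature.MathematicalPhysics.StatisticalMechanics (lennardJones IsMuGSC)
open Summit.AtomisticToContinuum.Crystallization.Theses.PalmUnimodularRigidity (MinimiserShells)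
open Summit.AtomisticToContinuum.Crystallization.Theorems.MinimiserShells.Negative.LoadBearing
  (eStar meanRootEnergy GoodShell minimiserShells_iff)
open Summit.AtomisticToContinuum.Crystallization.Theorems.PalmUnimodularRigidityMinimiserShells

/-- **P3a is implied by crux 9225** (`MinimiserShells`): drop the funnel hypothesis. -/
theorem funnelToShells_of_minimiserShells : MinimiserShells → FunnelToShells := by
  intro h δ hδ P hP hcore hstat hE _
  exact (minimiserShells_iff.1 h) δ hδ P hP hcore hstat hE

/-- **The deterministic sufficient condition for P3a.**  THRESHOLD PRICING of deep badly-shelled sites on large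
cube windows of everywhere-`SetGood` e*-`μ`GSCs (the last open stub S7″ of crux 9225's line, restricted to the
funnel) implies `FunnelToShells`, through the class-general transfer machinery landed for crux 9225
(`EquilibriumInLaw`, `EnergyFloor`, `SlackEventTransfer`, `ThresholdTransfer.ae_goodShell_of_thresholdBadPricing`). -/
theorem funnelToShells_of_funnelThresholdPricing
    (hprice : ∀ δ : ℝ, 0 < δ → ∀ t : ℝ, 0 < t → ∃ L₀ R₀ κ : ℝ, 0 < L₀ ∧ 0 < R₀ ∧ 0 < κ ∧
      ∀ S : Set (EuclideanSpace ℝ (Fin 3)), (∀ x ∈ S, ∀ z ∈ S, x ≠ z → δ ≤ dist x z) →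
        IsMuGSC lennardJones eStar S → (∀ y ∈ S, SetGood S y) →
        ∀ L : ℝ, L₀ ≤ L → ∀ a : Fin 3 → ℝ, ∀ C : Finset (EuclideanSpace ℝ (Fin 3)),
          (↑C : Set (EuclideanSpace ℝ (Fin 3))) =
            S ∩ {z : EuclideanSpace ℝ (Fin 3) | ∀ i, a i ≤ z i ∧ z i < a i + L} →
        ∀ G : Finset (EuclideanSpace ℝ (Fin 3)), G ⊆ C →
          (∀ y ∈ G, ¬ GoodShell ((Measure.count : Measure (EuclideanSpace ℝ (Fin 3))).restrict
              ((fun z => z - y) '' S)) ∧ S ∩ Metric.closedBall y R₀ ⊆ ↑C) →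
          t * (C.card : ℝ) ≤ (G.card : ℝ) →
          (C.card : ℝ) * (eStar + κ) ≤ (∑ x ∈ C, ∑ z ∈ C, lennardJones (dist x z)) / 2) :
    FunnelToShells := by
  intro δ hδ P hP hcore hstat hE hgood
  -- a.e. configuration is an e*-μGSC (S1 fed with S2) ...
  have hGSC : ∀ᵐ μ ∂P, ∃ S : Set (EuclideanSpace ℝ (Fin 3)),
      μ = (Measure.count : Measure (EuclideanSpace ℝ (Fin 3))).restrict S ∧ IsMuGSC lennardJones eStar S :=
    EquilibriumInLaw.stub_equilibriumInLaw EnergyFloor.stub_energyFloor δ hδ P hP hcore hstat hE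
  -- ... and everywhere `SetGood`: the class `K`
  have hK : ∀ᵐ μ ∂P, ∃ S : Set (EuclideanSpace ℝ (Fin 3)),
      μ = (Measure.count : Measure (EuclideanSpace ℝ (Fin 3))).restrict S ∧
        (IsMuGSC lennardJones eStar S ∧ ∀ y ∈ S, SetGood S y) := by
    filter_upwards [hGSC, hgood] with μ h₁ h₂
    obtain ⟨S, hμ, hS⟩ := h₁
    obtain ⟨S', hμ', hS'⟩ := h₂
    have hSS' : S' = S := eq_of_count_restrict_eq (hμ'.symm.trans hμ)
    subst hSS'
    exact ⟨S', hμ, hS, hS'⟩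
  haveI := hP
  exact ThresholdTransfer.ae_goodShell_of_thresholdBadPricing SlackEventTransfer.stub_slackEventTransfer hδ hcore
    hstat hE hK (fun t ht => by
      obtain ⟨L₀, R₀, κ, hL₀, hR₀, hκ, h⟩ := hprice δ hδ t ht
      exact ⟨L₀, R₀, κ, hL₀, hR₀, hκ, fun S hsep hKS => h S hsep hKS.1 hKS.2⟩)

/-- The funnel pricing is a trivial weakening of the UNRESTRICTED threshold pricing S7″ of crux 9225's line
(`stub_thresholdBadPricing`, open there): forget the everywhere-`SetGood` hypothesis. -/
theorem funnelThresholdPricing_of_thresholdBadPricing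
    (hS7 : ∀ δ : ℝ, 0 < δ → ∀ t : ℝ, 0 < t → ∃ L₀ R₀ κ : ℝ, 0 < L₀ ∧ 0 < R₀ ∧ 0 < κ ∧
      ∀ S : Set (EuclideanSpace ℝ (Fin 3)), (∀ x ∈ S, ∀ z ∈ S, x ≠ z → δ ≤ dist x z) →
        IsMuGSC lennardJones eStar S →
        ∀ L : ℝ, L₀ ≤ L → ∀ a : Fin 3 → ℝ, ∀ C : Finset (EuclideanSpace ℝ (Fin 3)),
          (↑C : Set (EuclideanSpace ℝ (Fin 3))) =
            S ∩ {z : EuclideanSpace ℝ (Fin 3) | ∀ i, a i ≤ z i ∧ z i < a i + L} →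
        ∀ G : Finset (EuclideanSpace ℝ (Fin 3)), G ⊆ C →
          (∀ y ∈ G, ¬ GoodShell ((Measure.count : Measure (EuclideanSpace ℝ (Fin 3))).restrict
              ((fun z => z - y) '' S)) ∧ S ∩ Metric.closedBall y R₀ ⊆ ↑C) →
          t * (C.card : ℝ) ≤ (G.card : ℝ) →
          (C.card : ℝ) * (eStar + κ) ≤ (∑ x ∈ C, ∑ z ∈ C, lennardJones (dist x z)) / 2) :
    ∀ δ : ℝ, 0 < δ → ∀ t : ℝ, 0 < t → ∃ L₀ R₀ κ : ℝ, 0 < L₀ ∧ 0 < R₀ ∧ 0 < κ ∧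
      ∀ S : Set (EuclideanSpace ℝ (Fin 3)), (∀ x ∈ S, ∀ z ∈ S, x ≠ z → δ ≤ dist x z) →
        IsMuGSC lennardJones eStar S → (∀ y ∈ S, SetGood S y) →
        ∀ L : ℝ, L₀ ≤ L → ∀ a : Fin 3 → ℝ, ∀ C : Finset (EuclideanSpace ℝ (Fin 3)),
          (↑C : Set (EuclideanSpace ℝ (Fin 3))) =
            S ∩ {z : EuclideanSpace ℝ (Fin 3) | ∀ i, a i ≤ z i ∧ z i < a i + L} →
        ∀ G : Finset (EuclideanSpace ℝ (Fin 3)), G ⊆ C →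
          (∀ y ∈ G, ¬ GoodShell ((Measure.count : Measure (EuclideanSpace ℝ (Fin 3))).restrict
              ((fun z => z - y) '' S)) ∧ S ∩ Metric.closedBall y R₀ ⊆ ↑C) →
          t * (C.card : ℝ) ≤ (G.card : ℝ) →
          (C.card : ℝ) * (eStar + κ) ≤ (∑ x ∈ C, ∑ z ∈ C, lennardJones (dist x z)) / 2 := by
  intro δ hδ t ht
  obtain ⟨L₀, R₀, κ, hL₀, hR₀, hκ, h⟩ := hS7 δ hδ t ht
  exact ⟨L₀, R₀, κ, hL₀, hR₀, hκ, fun S hsep hGSC _ => h S hsep hGSC⟩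

/-- Hence P3a is implied by the unrestricted threshold pricing S7″ (the one open stub of crux 9225's line): crux
13603 is closed modulo {S7″ or its funnel restriction, crux 9227, crux 9226}. -/
theorem funnelToShells_of_thresholdBadPricing
    (hS7 : ∀ δ : ℝ, 0 < δ → ∀ t : ℝ, 0 < t → ∃ L₀ R₀ κ : ℝ, 0 < L₀ ∧ 0 < R₀ ∧ 0 < κ ∧
      ∀ S : Set (EuclideanSpace ℝ (Fin 3)), (∀ x ∈ S, ∀ z ∈ S, x ≠ z → δ ≤ dist x z) →
        IsMuGSC lennardJones eStar S →
        ∀ L : ℝ, L₀ ≤ L → ∀ a : Fin 3 → ℝ, ∀ C : Finset (EuclideanSpace ℝ (Fin 3)),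
          (↑C : Set (EuclideanSpace ℝ (Fin 3))) =
            S ∩ {z : EuclideanSpace ℝ (Fin 3) | ∀ i, a i ≤ z i ∧ z i < a i + L} →
        ∀ G : Finset (EuclideanSpace ℝ (Fin 3)), G ⊆ C →
          (∀ y ∈ G, ¬ GoodShell ((Measure.count : Measure (EuclideanSpace ℝ (Fin 3))).restrict
              ((fun z => z - y) '' S)) ∧ S ∩ Metric.closedBall y R₀ ⊆ ↑C) →
          t * (C.card : ℝ) ≤ (G.card : ℝ) →
          (C.card : ℝ) * (eStar + κ) ≤ (∑ x ∈ C, ∑ z ∈ C, lennardJones (dist x z)) / 2) :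
    FunnelToShells :=
  funnelToShells_of_funnelThresholdPricing (funnelThresholdPricing_of_thresholdBadPricing hS7)

end Summit.AtomisticToContinuum.Crystallization.Theorems.PalmGoodLaw

end
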